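import Summits.QuantumFields.BalabanUV.T4Continuum.Support.NE7TopLandauLinks
import Summits.QuantumFields.BalabanUV.T4Continuum.Support.NE7MajorantL1
import Summits.QuantumFields.BalabanUV.T4Continuum.Support.NE7ApeTrivialFlatEndGradient
import HarnessLib

/-!
# NE7RepFlatLinksOfTanCritical — ROAD v4, assembly D6∕D7: the two link binders of G7 (REP♭⁻) at a tangent-critical, block-flat, small-field configuration —
# `‖U^{u₀} − 1‖ ≤ C₀·M·ε` and `‖U^{u₀}(b + e_τ) − U^{u₀}(b)‖ ≤ C₅·ε` ([B8] Theorem 2 (i)'s sizes `δ∕M`, `δ∕M²`), from tangent-criticality and smallness ALONE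

Cell `pub-balaban`, rung (B)+1 sub-cell t4, lineage `b2b-balaban-t4-ne7-p1`, generation 74 (CRUX PROVER NE7 #1, OWNER row NE7).  Memo `REP-FLAT-ROAD-v4.md` §4.
COMPOSITION of D5 `NE7TopLandauLinks.exists_top_landau_links_flatTop` (both binders from a bound `j` on lit-balaban's `covDiv 1 (U^u)` in every unitary periodic
gauge) with R4 `NE7CovDivB8Letter.norm_covDiv_le_of_tanCritical` ([B8] (1.2)∕(1.9) at a tangent-critical configuration, every unitary gauge, every bond of the period
box), the periodic-box reduction (§1: `covDiv` of periodic data is periodic, so a bound on the period box is a bound everywhere), and (§3) the DISCHARGE of R4's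
(160) hypothesis by `NE7MajorantL1.sum_norm_QbarIter_sub_flat_le` (`Λ = 2K_maj·(L∕L^{d+1})^{k+1}`, the order of R4's companion term), after which `M·j_R = O(ε)`.

WHAT ([folklore]; 0 def, 0 sorry; every dimension `d + 1`, `n : Type`).
§1 `norm_covDiv_le_of_box` (periodicity of `covDiv` is t4-ne7-p2's `NE7ApeTrivialFlatEndGradient.covDiv_add_period`, BY NAME).
§2 **`exists_rep_flat_links_of_tanCritical`**: `∃ C₀ C₃ C₄ θ₂ > 0` (on `d`, `card n`, `L`) such that for all `k, N` and every unitary `(L^{k+1}N)`-periodic `U` with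
   plaquettes `≤ ε ≤ 1∕4`, `cavgIter L (k+1) U = flat`, `M²ε ≤ θ₂` (`M = L^{k+1}`), R4's crude smallness (`x`: `LevelSmall`, `cruxC·M²x < 1`, `thetaLoc·M²x < 1`,
   `M²x ≤ 1`, plaquettes `≤ x`), the (160) docking hypothesis with constant `Λ ≥ 0` and TANGENT-CRITICALITY (`dirIter L (k+1) U Y = 0 ⇒ dAction U Y = 0` on skew
   periodic `Y`): some unitary periodic `u₀` has `‖U^{u₀}(y,κ) − 1‖ ≤ C₀·M·ε` and
   `‖U^{u₀}(y + e_τ, κ) − U^{u₀}(y, κ)‖ ≤ C₃·M·j_R + C₄·ε`, `j_R = card n·(ε·c_R·(Λ + (L∕L^{d+1})^{k+1}) + 12·#Plane·ε²) + 8(d+1)ε²`,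
   `c_R = (curl1C∕(1 − thetaLoc·M²x))·M^{d+1}∕M²` — R4's (1.9) bound with `η = 1`, `a = ε`.  With `Λ = O(δ·M^{−(d+1)})` ((160)) every term of `M·j_R` is `O(ε)`:
   `hr₁ = O(δ∕M²)`, `hr₀ = O(δ∕M)` — the sizes G7 `NE7ApeTrivialFlatEndLinks.smallField_of_trivialLetters_links` consumes.
§3 **`exists_rep_flat_links_critical`** (D7, REP♭⁻): `∃ C₀ C₅ θ₂ > 0` (on `d`, `card n`, `L`): for all `k, N`, every unitary `(L^{k+1}N)`-periodic `U` with plaquettes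
   `≤ ε ≤ 1∕4`, `cavgIter L (k+1) U = flat`, `M²ε ≤ θ₂`, the crude multi-level smallness in `x` (`LevelSmall`, plaquettes `≤ x`, `cruxC·M²x < 1`, `thetaLoc·M²x ≤ 1∕2`,
   `M²x ≤ 1`) and TANGENT-CRITICALITY: some unitary periodic `u₀` has `‖U^{u₀}(y,κ) − 1‖ ≤ C₀·M·ε` and `‖U^{u₀}(y + e_τ, κ) − U^{u₀}(y, κ)‖ ≤ C₅·ε` — NO `Λ`, no
   representative, no chart among the hypotheses.

HONEST FRAMING (page 1): composition by name of this lineage's ROAD v4 (D4 exact top Landau gauge over the v2 END, T5 gradient letter, R4 current letter, (160) by the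
majorant tower); tangent-criticality and the smallness lines remain the HYPOTHESES (they are what (APE)'s bootstrap supplies); REP♭⁻ is now a THEOREM at such
configurations, but (APE) at the trivial flat datum still needs the G5–G7 docking (pending files of gen 72) — NOT claimed here; NOT NE7; spine 0∕9; finite T⁴ rung
(B)+1 — NOT infinite volume, NOT mass gap, NOT Clay.  Continuum YM on T⁴ ⇐ BetaPertH ∧ nine spine estimates (0/9 proved); BetaPertH ⇐ (D1) ∧ (D4) ∧ CAP+tail;
G-an2-4 gates asym, D1 and NE2/3/4.
-/

set_option autoImplicit false

open scoped BigOperators Matrix Matrix.Norms.L2Operator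
open NormedSpace Finset

namespace Summit.QuantumFields.BalabanUV.T4Continuum.NE7RepFlatLinksOfTanCritical

open Literature.MathematicalPhysics.QuantumFieldTheory.Balaban1983to89
open B7Prop1Explicit B7Prop2Explicit MatrixLog
open T4AveragingDeficitWall (IsUnitaryCfg IsSkewDir SmallField dirL1)
open T4AveragingDeficitWallBoundary (IsPeriodicCfg periodBox mem_periodBox)
open AveragingDeficitPeriodicCounting (IsPeriodicDir)
open AveragingDeficitMultiLevelPrep (cavgIter LevelSmall)
open AveragingDeficitTorusChart (periodic_smul_vec)
open MinimalActionLevels (perWin)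
open BlockAveragePushDirSplit (flat)
open NE3EnergyShapes (IsUnitarySite IsPeriodicSite)
open NE3SmoothLiftW (isPeriodicCfg_gaugeAct)
open NE3TangentCovariantTower (dirIter QbarIter)
open NE3HessForm (dAction)
open NE3QbarIterCovLiftPrep (cruxC)
open NE3RightInverseSolveLetters (thetaLoc)
open NE3HatInvCurlLetters (curl1C curl1C_nonneg)
open AveragingDeficitTwoLevelPrep (twoLevelSmall)
open BlockAverageVaryHolo (nbRad)
open NE7MajorantL1 (sum_norm_QbarIter_sub_flat_le)
open B8Ineq132 (covDiv)
open B6LowerBound2153Torus (toT rep isPeriod_rep_toT_sub)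
open NE7CovDivB8Letter (norm_covDiv_le_of_tanCritical)
open NE7TopLandauLinks (exists_top_landau_links_flatTop)

noncomputable section

variable {d : ℕ} {n : Type} [Fintype n] [DecidableEq n]

/-! ## §1 A bound on the period box is a bound everywhere (periodic data) -/

section Periodic

/-- A bound for `covDiv η V μ` on the period box of a `P`-periodic `V` holds at every site. [folklore] -/
theorem norm_covDiv_le_of_box {P : ℕ} [NeZero P] {V : Site (d + 1) → Fin (d + 1) → (Matrix n n ℂ)ˣ} (hV : IsPeriodicCfg V (P : ℤ)) (η : ℝ)
    (μ : Fin (d + 1)) {j : ℝ} (hj : ∀ x ∈ periodBox (d := d + 1) P, ‖covDiv η V μ x‖ ≤ j) (x : Site (d + 1)) : ‖covDiv η V μ x‖ ≤ j := by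
  set x₀ : Site (d + 1) := rep (fun _ : Fin (d + 1) => P) (toT (fun _ : Fin (d + 1) => P) x) with hx₀
  have hx₀B : x₀ ∈ periodBox (d := d + 1) P :=
    mem_periodBox.2 fun κ => ⟨Int.natCast_nonneg _, by simp only [hx₀, rep]; exact_mod_cast ZMod.val_lt _⟩
  have hper := isPeriod_rep_toT_sub (fun _ : Fin (d + 1) => P) x
  choose c hc using hper
  have hx : x = x₀ + (P : ℤ) • (fun i => -c i) := by
    funext i
    have h := hc i
    simp only [Pi.sub_apply] at h
    simp only [Pi.add_apply, Pi.smul_apply, smul_eq_mul, mul_neg]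
    linarith
  rw [hx, periodic_smul_vec (f := fun y => covDiv η V μ y) (fun y κ => NE7ApeTrivialFlatEndGradient.covDiv_add_period hV η μ y κ) x₀ _]
  exact hj x₀ hx₀B

end Periodic

/-! ## §2 REP♭⁻ at a tangent-critical block-flat configuration, modulo the (160) docking constant -/

section Assembly

/-- **D6, REP♭⁻ FROM TANGENT-CRITICALITY MODULO `Λ`.**  `∃ C₀ C₃ C₄ θ₂ > 0`: for all `k, N`, every unitary `(L^{k+1}N)`-periodic `U` with plaquettes `≤ ε ≤ 1∕4`,
`cavgIter L (k+1) U = flat`, `M²ε ≤ θ₂`, R4's crude smallness in `x`, the (160) hypothesis with constant `Λ` and tangent-criticality, some unitary periodic `u₀` has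
`‖U^{u₀} − 1‖ ≤ C₀Mε` on links and `‖U^{u₀}(y + e_τ, κ) − U^{u₀}(y, κ)‖ ≤ C₃·M·j_R + C₄·ε` with R4's `j_R` (`η = 1`, `a = ε`). [folklore] -/
theorem exists_rep_flat_links_of_tanCritical [Nonempty n] {L : ℕ} (hL : 2 ≤ L) :
    ∃ C₀ C₃ C₄ θ₂ : ℝ, 0 < C₀ ∧ 0 < C₃ ∧ 0 < C₄ ∧ 0 < θ₂ ∧ ∀ (k N : ℕ) [NeZero N] [NeZero (L ^ (k + 1))]
      (U : Site (d + 1) → Fin (d + 1) → (Matrix n n ℂ)ˣ) (ε x Λ : ℝ),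
      IsUnitaryCfg U → IsPeriodicCfg U ((L ^ (k + 1) * N : ℕ) : ℤ) → 0 ≤ ε → ε ≤ 1 / 4 → SmallField U ε → cavgIter L (k + 1) U = flat →
      ((L : ℝ) ^ (k + 1)) ^ 2 * ε ≤ θ₂ →
      0 ≤ x → LevelSmall (d + 1) L k x → SmallField U x →
      cruxC (d + 1) L * (((L : ℝ) ^ (k + 1)) ^ 2 * x) < 1 → thetaLoc (d + 1) L * (((L : ℝ) ^ (k + 1)) ^ 2 * x) < 1 → ((L : ℝ) ^ (k + 1)) ^ 2 * x ≤ 1 →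
      0 ≤ Λ →
      (∀ Y : Site (d + 1) → Fin (d + 1) → Matrix n n ℂ, IsSkewDir Y → IsPeriodicDir Y ((N * L ^ (k + 1) : ℕ) : ℤ) →
        ∑ z ∈ periodBox N, ∑ κ : Fin (d + 1), ‖QbarIter L (k + 1) U Y z κ - QbarIter L (k + 1) (flat (d := d + 1) (n := n)) Y z κ‖
          ≤ Λ * dirL1 Y (periodBox (d := d + 1) (N * L ^ (k + 1)))) →
      (∀ Y' : Site (d + 1) → Fin (d + 1) → Matrix n n ℂ, IsSkewDir Y' → IsPeriodicDir Y' ((N * L ^ (k + 1) : ℕ) : ℤ) →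
        dirIter L (k + 1) U Y' = 0 → dAction U Y' (perWin (d + 1) (N * L ^ (k + 1))) = 0) →
      ∃ u₀ : Site (d + 1) → (Matrix n n ℂ)ˣ, IsUnitarySite u₀ ∧ IsPeriodicSite u₀ ((L ^ (k + 1) * N : ℕ) : ℤ) ∧
        (∀ (y : Site (d + 1)) (κ : Fin (d + 1)), ‖((gaugeAct u₀ U y κ : (Matrix n n ℂ)ˣ) : Matrix n n ℂ) - 1‖ ≤ C₀ * (L : ℝ) ^ (k + 1) * ε) ∧
        (∀ (y : Site (d + 1)) (κ τ : Fin (d + 1)),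
          ‖((gaugeAct u₀ U (y + e τ) κ : (Matrix n n ℂ)ˣ) : Matrix n n ℂ) - ((gaugeAct u₀ U y κ : (Matrix n n ℂ)ˣ) : Matrix n n ℂ)‖
            ≤ C₃ * (L : ℝ) ^ (k + 1)
                * (Fintype.card n *
                    ((ε * ((curl1C (d + 1) L / (1 - thetaLoc (d + 1) L * (((L : ℝ) ^ (k + 1)) ^ 2 * x)))
                        * (((L : ℝ) ^ (k + 1)) ^ (d + 1) / ((L : ℝ) ^ (k + 1)) ^ 2))) * (Λ + ((L : ℝ) / (L : ℝ) ^ (d + 1)) ^ (k + 1))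
                      + 12 * (Fintype.card (T4AveragingDeficitWall.Plane (d + 1)) : ℝ) * ε ^ 2)
                    + 8 * ((d + 1 : ℕ) : ℝ) * ε ^ 2)
              + C₄ * ε) := by
  obtain ⟨C₀, C₃, C₄, θ₂, hC₀, hC₃, hC₄, hθ₂, hD5⟩ := exists_top_landau_links_flatTop (d := d) (n := n) hL
  refine ⟨C₀, C₃, C₄, θ₂, hC₀, hC₃, hC₄, hθ₂, fun k N _ _ U ε x Λ hUu hUP hε hε4 hUε hflat hsmall hx hs hUx hθ hθl hx1 hΛ0 hΛ hcrit => ?_⟩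
  haveI : NeZero (N * L ^ (k + 1)) := ⟨Nat.mul_ne_zero (NeZero.ne N) (NeZero.ne (L ^ (k + 1)))⟩
  have hUP' : IsPeriodicCfg U ((N * L ^ (k + 1) : ℕ) : ℤ) := by rw [Nat.mul_comm]; exact hUP
  -- R4 in every unitary periodic gauge, at every site (η = 1)
  have hJ : ∀ u : Site (d + 1) → (Matrix n n ℂ)ˣ, IsUnitarySite u → IsPeriodicSite u ((L ^ (k + 1) * N : ℕ) : ℤ) →
      ∀ (y : Site (d + 1)) (κ : Fin (d + 1)), ‖covDiv 1 (gaugeAct u U) κ y‖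
        ≤ Fintype.card n *
            ((ε * ((curl1C (d + 1) L / (1 - thetaLoc (d + 1) L * (((L : ℝ) ^ (k + 1)) ^ 2 * x)))
                * (((L : ℝ) ^ (k + 1)) ^ (d + 1) / ((L : ℝ) ^ (k + 1)) ^ 2))) * (Λ + ((L : ℝ) / (L : ℝ) ^ (d + 1)) ^ (k + 1))
              + 12 * (Fintype.card (T4AveragingDeficitWall.Plane (d + 1)) : ℝ) * ε ^ 2)
            + 8 * ((d + 1 : ℕ) : ℝ) * ε ^ 2 := by
    intro u hu huP y κ
    have huP' : ∀ (z : Site (d + 1)) (i : Fin (d + 1)), u (z + (((N * L ^ (k + 1) : ℕ) : ℤ)) • e i) = u z := by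
      rw [Nat.mul_comm]; exact huP
    have hWP : IsPeriodicCfg (gaugeAct u U) ((N * L ^ (k + 1) : ℕ) : ℤ) := isPeriodicCfg_gaugeAct huP' hUP'
    refine norm_covDiv_le_of_box hWP 1 κ (fun x₀ hx₀ => ?_) y
    have h := norm_covDiv_le_of_tanCritical (d := d + 1) hL k hUu hUP' hx hs hUx hθ hθl hx1 hε hε4 hUε hflat hΛ0 hΛ hcrit hu one_ne_zero hx₀ κ
    rwa [abs_one, inv_one, one_mul] at h
  exact hD5 k N U ε _ hUu hε hUε hUP hflat hsmall hJ

end Assembly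

/-! ## §3 REP♭⁻: the (160) constant discharged, both binders in closed `O(·)` form -/

section Critical

/-- **D7, REP♭⁻ AT A TANGENT-CRITICAL BLOCK-FLAT SMALL-FIELD CONFIGURATION.**  `∃ C₀ C₅ θ₂ > 0` (on `d`, `card n`, `L`): for all `k, N`, every unitary
`(L^{k+1}N)`-periodic `U` with plaquettes `≤ ε ≤ 1∕4`, `cavgIter L (k+1) U = flat`, `M²ε ≤ θ₂` (`M = L^{k+1}`), the crude multi-level smallness in `x` and
tangent-criticality, some unitary periodic gauge `u₀` has `‖U^{u₀}(y, κ) − 1‖ ≤ C₀·M·ε` and `‖U^{u₀}(y + e_τ, κ) − U^{u₀}(y, κ)‖ ≤ C₅·ε` — [B8] Theorem 2 (i)'s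
sizes `B(α₀+α₁)η`, `B(α₀+α₁)η²` (`η = M⁻¹`, `α ∝ δ = M²ε`). [folklore] -/
theorem exists_rep_flat_links_critical [Nonempty n] {L : ℕ} (hL : 2 ≤ L) :
    ∃ C₀ C₅ θ₂ : ℝ, 0 < C₀ ∧ 0 < C₅ ∧ 0 < θ₂ ∧ ∀ (k N : ℕ) [NeZero N] [NeZero (L ^ (k + 1))]
      (U : Site (d + 1) → Fin (d + 1) → (Matrix n n ℂ)ˣ) (ε x : ℝ),
      IsUnitaryCfg U → IsPeriodicCfg U ((L ^ (k + 1) * N : ℕ) : ℤ) → 0 ≤ ε → ε ≤ 1 / 4 → SmallField U ε → cavgIter L (k + 1) U = flat →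
      ((L : ℝ) ^ (k + 1)) ^ 2 * ε ≤ θ₂ →
      0 ≤ x → LevelSmall (d + 1) L k x → SmallField U x →
      cruxC (d + 1) L * (((L : ℝ) ^ (k + 1)) ^ 2 * x) < 1 → thetaLoc (d + 1) L * (((L : ℝ) ^ (k + 1)) ^ 2 * x) ≤ 1 / 2 →
      ((L : ℝ) ^ (k + 1)) ^ 2 * x ≤ 1 →
      (∀ Y' : Site (d + 1) → Fin (d + 1) → Matrix n n ℂ, IsSkewDir Y' → IsPeriodicDir Y' ((N * L ^ (k + 1) : ℕ) : ℤ) →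
        dirIter L (k + 1) U Y' = 0 → dAction U Y' (perWin (d + 1) (N * L ^ (k + 1))) = 0) →
      ∃ u₀ : Site (d + 1) → (Matrix n n ℂ)ˣ, IsUnitarySite u₀ ∧ IsPeriodicSite u₀ ((L ^ (k + 1) * N : ℕ) : ℤ) ∧
        (∀ (y : Site (d + 1)) (κ : Fin (d + 1)), ‖((gaugeAct u₀ U y κ : (Matrix n n ℂ)ˣ) : Matrix n n ℂ) - 1‖ ≤ C₀ * (L : ℝ) ^ (k + 1) * ε) ∧
        (∀ (y : Site (d + 1)) (κ τ : Fin (d + 1)),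
          ‖((gaugeAct u₀ U (y + e τ) κ : (Matrix n n ℂ)ˣ) : Matrix n n ℂ) - ((gaugeAct u₀ U y κ : (Matrix n n ℂ)ˣ) : Matrix n n ℂ)‖ ≤ C₅ * ε) := by
  obtain ⟨C₀, C₃, C₄, θ₂, hC₀, hC₃, hC₄, hθ₂, hD6⟩ := exists_rep_flat_links_of_tanCritical (d := d) (n := n) hL
  obtain ⟨D, hDdef⟩ : ∃ D : ℝ, D = ((d + 1 : ℕ) : ℝ) := ⟨_, rfl⟩
  have hD0 : 0 ≤ D := by rw [hDdef]; exact Nat.cast_nonneg _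
  -- the majorant constant of `NE7MajorantL1` in dimension `d + 1`
  obtain ⟨Km, hKm⟩ : ∃ Km : ℝ, Km = Real.exp (((L : ℝ) ^ (d + 1) / L) * ((((d + 1 : ℕ) : ℝ)) * (16 * ((((d + 1 : ℕ) : ℝ)) + 1) * ((((d + 1 : ℕ) : ℝ)) + 4) * (L : ℝ) ^ 2)
      * (1250 * ((nbRad (d + 1) L : ℝ) + L) + 8 * ((((d + 1 : ℕ) : ℝ)) * L) + 2 * L)) * (2 / twoLevelSmall (d + 1) L)) := ⟨_, rfl⟩
  have hKm0 : 0 < Km := by rw [hKm]; exact Real.exp_pos _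
  obtain ⟨C₅, hC₅⟩ : ∃ C₅ : ℝ, C₅ = C₃ * (Fintype.card n * (2 * curl1C (d + 1) L * (2 * Km + 1)
      + 12 * (Fintype.card (T4AveragingDeficitWall.Plane (d + 1)) : ℝ) * θ₂) + 8 * D * θ₂) + C₄ := ⟨_, rfl⟩
  have hcurl0 := curl1C_nonneg (d + 1) L
  have hC₅0 : 0 < C₅ := by rw [hC₅]; positivity
  refine ⟨C₀, C₅, θ₂, hC₀, hC₅0, hθ₂, fun k N _ _ U ε x hUu hUP hε hε4 hUε hflat hsmall hx hs hUx hθ hθl hx1 hcrit => ?_⟩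
  -- the scale
  have hL1 : (1 : ℝ) ≤ L := by exact_mod_cast (show 1 ≤ L by omega)
  set M : ℝ := (L : ℝ) ^ (k + 1) with hM
  have hM1 : 1 ≤ M := one_le_pow₀ hL1
  have hM0 : 0 < M := by linarith
  set m : ℝ := ((L : ℝ) / (L : ℝ) ^ (d + 1)) ^ (k + 1) with hm
  have hm0 : 0 ≤ m := by rw [hm]; positivity
  have hmM : m * M ^ (d + 1) = M := by
    rw [hm, hM, div_pow, ← pow_mul, ← pow_mul, show (d + 1) * (k + 1) = (k + 1) * (d + 1) by ring]
    exact div_mul_cancel₀ _ (pow_ne_zero _ (by positivity))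
  -- (160) discharged: `Λ = 2·Km·m`
  have hΛ0 : 0 ≤ 2 * Km * m := by positivity
  have hΛ : ∀ Y : Site (d + 1) → Fin (d + 1) → Matrix n n ℂ, IsSkewDir Y → IsPeriodicDir Y ((N * L ^ (k + 1) : ℕ) : ℤ) →
      ∑ z ∈ periodBox N, ∑ κ : Fin (d + 1), ‖QbarIter L (k + 1) U Y z κ - QbarIter L (k + 1) (flat (d := d + 1) (n := n)) Y z κ‖
        ≤ (2 * Km * m) * dirL1 Y (periodBox (d := d + 1) (N * L ^ (k + 1))) := by
    intro Y _ hYP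
    have h := sum_norm_QbarIter_sub_flat_le (d := d + 1) hL k hUu hx hs hUx hYP
    rw [hKm, hm]
    convert h using 2
  obtain ⟨u₀, hu₀, hu₀P, hr₀, hr₁⟩ :=
    hD6 k N U ε x (2 * Km * m) hUu hUP hε hε4 hUε hflat hsmall hx hs hUx hθ (by linarith) hx1 hΛ0 hΛ hcrit
  clear hD6 hΛ hcrit
  refine ⟨u₀, hu₀, hu₀P, hr₀, fun y κ τ => (hr₁ y κ τ).trans ?_⟩
  clear hr₁ hr₀
  -- arithmetic: `C₃·M·j_R + C₄·ε ≤ C₅·ε`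
  rw [← hM]
  have hθpos : 1 / 2 ≤ 1 - thetaLoc (d + 1) L * (M ^ 2 * x) := by linarith
  have hcC : curl1C (d + 1) L / (1 - thetaLoc (d + 1) L * (M ^ 2 * x)) ≤ 2 * curl1C (d + 1) L := by
    rw [div_le_iff₀ (by linarith)]
    nlinarith
  have hcC0 : 0 ≤ curl1C (d + 1) L / (1 - thetaLoc (d + 1) L * (M ^ 2 * x)) := div_nonneg hcurl0 (by linarith)
  -- the leading term: `M·ε·c_C·(M^{d+1}/M²)·(Λ + m) = ε·c_C·(2Km+1)` EXACTLY
  have hlead : M * (ε * ((curl1C (d + 1) L / (1 - thetaLoc (d + 1) L * (M ^ 2 * x))) * (M ^ (d + 1) / M ^ 2)) * (2 * Km * m + m))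
      = ε * (curl1C (d + 1) L / (1 - thetaLoc (d + 1) L * (M ^ 2 * x))) * (2 * Km + 1) := by
    have hkey : M * (M ^ (d + 1) / M ^ 2) * m = 1 := by
      rw [mul_comm m (M ^ (d + 1))] at hmM
      rw [mul_assoc, div_mul_eq_mul_div, hmM]
      field_simp
    calc M * (ε * ((curl1C (d + 1) L / (1 - thetaLoc (d + 1) L * (M ^ 2 * x))) * (M ^ (d + 1) / M ^ 2)) * (2 * Km * m + m))
        = ε * (curl1C (d + 1) L / (1 - thetaLoc (d + 1) L * (M ^ 2 * x))) * (2 * Km + 1) * (M * (M ^ (d + 1) / M ^ 2) * m) := by ring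
      _ = _ := by rw [hkey, mul_one]
  have hMε2 : M * ε ^ 2 ≤ θ₂ * ε := by
    have h1 : M * ε ^ 2 = (M * ε) * ε := by ring
    have hMM : M ≤ M ^ 2 := by nlinarith [hM1]
    have h2 : M * ε ≤ M ^ 2 * ε := mul_le_mul_of_nonneg_right hMM hε
    rw [h1]
    exact mul_le_mul_of_nonneg_right (h2.trans hsmall) hε
  -- assemble
  have hMj : M * (Fintype.card n *
        ((ε * ((curl1C (d + 1) L / (1 - thetaLoc (d + 1) L * (M ^ 2 * x))) * (M ^ (d + 1) / M ^ 2))) * (2 * Km * m + m)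
          + 12 * (Fintype.card (T4AveragingDeficitWall.Plane (d + 1)) : ℝ) * ε ^ 2)
        + 8 * ((d + 1 : ℕ) : ℝ) * ε ^ 2)
      ≤ (Fintype.card n * (2 * curl1C (d + 1) L * (2 * Km + 1) + 12 * (Fintype.card (T4AveragingDeficitWall.Plane (d + 1)) : ℝ) * θ₂)
          + 8 * D * θ₂) * ε := by
    rw [← hDdef]
    have e1 : M * (Fintype.card n *
          ((ε * ((curl1C (d + 1) L / (1 - thetaLoc (d + 1) L * (M ^ 2 * x))) * (M ^ (d + 1) / M ^ 2))) * (2 * Km * m + m)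
            + 12 * (Fintype.card (T4AveragingDeficitWall.Plane (d + 1)) : ℝ) * ε ^ 2)
          + 8 * D * ε ^ 2)
        = Fintype.card n * (ε * (curl1C (d + 1) L / (1 - thetaLoc (d + 1) L * (M ^ 2 * x))) * (2 * Km + 1)
            + 12 * (Fintype.card (T4AveragingDeficitWall.Plane (d + 1)) : ℝ) * (M * ε ^ 2))
          + 8 * D * (M * ε ^ 2) := by
      rw [← hlead]; ring
    rw [e1]
    have t1 : ε * (curl1C (d + 1) L / (1 - thetaLoc (d + 1) L * (M ^ 2 * x))) * (2 * Km + 1) ≤ ε * (2 * curl1C (d + 1) L) * (2 * Km + 1) :=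
      mul_le_mul_of_nonneg_right (mul_le_mul_of_nonneg_left hcC hε) (by positivity)
    have t2 : 12 * (Fintype.card (T4AveragingDeficitWall.Plane (d + 1)) : ℝ) * (M * ε ^ 2)
        ≤ 12 * (Fintype.card (T4AveragingDeficitWall.Plane (d + 1)) : ℝ) * (θ₂ * ε) := mul_le_mul_of_nonneg_left hMε2 (by positivity)
    have t3 : 8 * D * (M * ε ^ 2) ≤ 8 * D * (θ₂ * ε) := mul_le_mul_of_nonneg_left hMε2 (by positivity)
    have t4 : Fintype.card n * (ε * (curl1C (d + 1) L / (1 - thetaLoc (d + 1) L * (M ^ 2 * x))) * (2 * Km + 1)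
            + 12 * (Fintype.card (T4AveragingDeficitWall.Plane (d + 1)) : ℝ) * (M * ε ^ 2))
        ≤ Fintype.card n * (ε * (2 * curl1C (d + 1) L) * (2 * Km + 1)
            + 12 * (Fintype.card (T4AveragingDeficitWall.Plane (d + 1)) : ℝ) * (θ₂ * ε)) :=
      mul_le_mul_of_nonneg_left (add_le_add t1 t2) (Nat.cast_nonneg _)
    linarith [t3, t4]
  rw [hC₅]
  have := mul_le_mul_of_nonneg_left hMj hC₃.le
  have e2 : (C₃ * (Fintype.card n * (2 * curl1C (d + 1) L * (2 * Km + 1)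
      + 12 * (Fintype.card (T4AveragingDeficitWall.Plane (d + 1)) : ℝ) * θ₂) + 8 * D * θ₂) + C₄) * ε
      = C₃ * ((Fintype.card n * (2 * curl1C (d + 1) L * (2 * Km + 1)
          + 12 * (Fintype.card (T4AveragingDeficitWall.Plane (d + 1)) : ℝ) * θ₂) + 8 * D * θ₂) * ε) + C₄ * ε := by ring
  rw [e2, mul_assoc]
  exact add_le_add this le_rfl

end Critical

end

end Summit.QuantumFields.BalabanUV.T4Continuum.NE7RepFlatLinksOfTanCritical
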